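import Summits.QuantumFields.YangMills.Theorems.UnitScaleTiltProp7DivRecoveryCutoffReadings
import Summits.QuantumFields.YangMills.Theorems.UnitScaleTiltProp7DivRecoveryAssemblyBudgetW4
import HarnessLib

/-!
# Prop. 7 on T³ — lane II [I-9]: THE TWO BOX WINDOWS AT THE RECORD RADIUS FROM AN `(L, s)`-ONLY SMALLNESS OF `e`

Route `UnitScaleTilt`, crux `MinimiserStabilityRegPr` (stmt-QuantumFields-19200), E′ growth side, lane II «divergence recovery at the curved regular member».
The chart bricks (B8-member) ✓`Prop7BoxLocalPotentialMember.boxLocalPotential_member` and w4-19200 g11's `Prop7BoxLocalResidualMember.boxLocalResidual_member`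
display two plaquette windows `hw : 64d³·2·R³(2R+1)·α² ≤ 1`, `hw4 : 832d³(2R+1)²R²·α² ≤ 1` at the chart radius `R`.  At the record radius
`R_f = (2L^s+1)ℓ + (ℓ−1)/2` (px9 g7 (Z-box)) and the plaquette currency `α ≤ e·η²` (px12 g8 (P-box): `α = regThreshold = e·η²`) both follow from the
single `K`-FREE smallness `29113344·L^{4s}·e² ≤ 1`, e.g. `e ≤ (5396·L^{2s})⁻¹` — by ✓`currency_window`∕`currency_window4` with `η·ℓ = 1`
(✓`eta_mul_level`), `R_f ≤ 4L^s·ℓ` (✓`recordRadius_le`), `1 ≤ L^s·ℓ`.  (px12 g8's (W-box) draft was withdrawn in favour of this by-name composition.)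

HONEST SCOPE.  Arithmetic; nothing of (REC)∕hN06∕the crux is proved here; YM₃ on T³ is rung R3 — NOT d = 4, NOT infinite volume, NOT a mass gap, NOT Clay.
[cite: Balaban1985BackgroundPropagators, (3.100) p.413]
-/

noncomputable section

namespace Summit.QuantumFields.YangMills.Theorems.Prop7DivRecoveryMemberWindows

open Literature.MathematicalPhysics.QuantumFieldTheory.Balaban1983to89
open Literature.MathematicalPhysics.QuantumFieldTheory.Balaban1983to89.T3ContinuumYM3Torus
open T3SectALandauChart (eta eta_pos)
open Summit.QuantumFields.YangMills.Theorems.Prop7DivRecoveryCutoffReadings (eta_mul_level one_le_radius_mul_level recordRadius_le recordRadius_nonneg)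
open Summit.QuantumFields.YangMills.Theorems.Prop7DivRecoveryAssemblyBudgetW4 (currency_window currency_window4)

variable (F : T3Family) (n K s : ℕ)

/-- ★★ **THE TWO BOX WINDOWS AT THE RECORD RADIUS** from `29113344·L^{4s}·e² ≤ 1`, for any plaquette size `0 ≤ α ≤ e·η²`. -/
theorem member_windows {e α : ℝ} (hα : 0 ≤ α) (hαe : α ≤ e * eta F n K ^ 2)
    (he : 29113344 * ((F.L : ℝ) ^ s) ^ 4 * e ^ 2 ≤ 1) :
    64 * ((F.P K).d : ℝ) ^ 3 * 2
        * (((2 * ((F.L ^ s : ℕ) : ℤ) + 1) * ((F.L ^ (K - n) : ℕ) : ℤ) + (((F.L ^ (K - n) : ℕ) : ℤ) - 1) / 2 : ℤ) : ℝ) ^ 3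
        * (2 * (((2 * ((F.L ^ s : ℕ) : ℤ) + 1) * ((F.L ^ (K - n) : ℕ) : ℤ) + (((F.L ^ (K - n) : ℕ) : ℤ) - 1) / 2 : ℤ) : ℝ) + 1) * α ^ 2 ≤ 1 ∧
    832 * ((F.P K).d : ℝ) ^ 3
        * (2 * (((2 * ((F.L ^ s : ℕ) : ℤ) + 1) * ((F.L ^ (K - n) : ℕ) : ℤ) + (((F.L ^ (K - n) : ℕ) : ℤ) - 1) / 2 : ℤ) : ℝ) + 1) ^ 2
        * (((2 * ((F.L ^ s : ℕ) : ℤ) + 1) * ((F.L ^ (K - n) : ℕ) : ℤ) + (((F.L ^ (K - n) : ℕ) : ℤ) - 1) / 2 : ℤ) : ℝ) ^ 2 * α ^ 2 ≤ 1 := by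
  have hd : (F.P K).d = 3 := T3Family.P_d F K
  have hℓη : eta F n K * (F.L : ℝ) ^ (K - n) = 1 := eta_mul_level F K n
  have hone : 1 ≤ (F.L : ℝ) ^ s * (F.L : ℝ) ^ (K - n) := one_le_radius_mul_level F K n s
  have hR0 := recordRadius_nonneg F K n s
  have hRf := recordRadius_le F K n s
  have hαe' : α ≤ 1 * e * eta F n K ^ 2 := by rw [one_mul]; exact hαe
  have hR4 : 0 ≤ ((F.L : ℝ) ^ s) ^ 4 * e ^ 2 := mul_nonneg (pow_nonneg (pow_nonneg (Nat.cast_nonneg _) _) _) (sq_nonneg e)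
  have hw1 : 1990656 * (1 : ℝ) ^ 2 * ((F.L : ℝ) ^ s) ^ 4 * e ^ 2 ≤ 1 := by nlinarith
  have hw2 : 29113344 * (1 : ℝ) ^ 2 * ((F.L : ℝ) ^ s) ^ 4 * e ^ 2 ≤ 1 := by rw [one_pow, mul_one]; exact he
  exact ⟨currency_window (d := (F.P K).d) hd hℓη hR0 hRf hone hα hαe' hw1,
    currency_window4 (d := (F.P K).d) hd hℓη hR0 hRf hone hα hαe' hw2⟩

/-- ★ **THE `(L, s)`-ONLY WINDOW**: `0 ≤ e ≤ (5396·L^{2s})⁻¹` implies `29113344·L^{4s}·e² ≤ 1` (`5396² = 29116816`). -/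
theorem window_of_le {e : ℝ} (he0 : 0 ≤ e) (he : e ≤ (5396 * ((F.L : ℝ) ^ s) ^ 2)⁻¹) :
    29113344 * ((F.L : ℝ) ^ s) ^ 4 * e ^ 2 ≤ 1 := by
  have hL1 : (1 : ℝ) ≤ F.L := by exact_mod_cast F.hL.2.le
  have hR1 : (1 : ℝ) ≤ (F.L : ℝ) ^ s := one_le_pow₀ hL1
  have hP : 0 < 5396 * ((F.L : ℝ) ^ s) ^ 2 := by positivity
  have h1 : 5396 * ((F.L : ℝ) ^ s) ^ 2 * e ≤ 1 := by
    have := mul_le_mul_of_nonneg_left he hP.le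
    rwa [mul_inv_cancel₀ hP.ne'] at this
  have h0 : 0 ≤ 5396 * ((F.L : ℝ) ^ s) ^ 2 * e := mul_nonneg hP.le he0
  have h2 : (5396 * ((F.L : ℝ) ^ s) ^ 2 * e) ^ 2 ≤ 1 := by
    calc (5396 * ((F.L : ℝ) ^ s) ^ 2 * e) ^ 2 ≤ 1 ^ 2 := pow_le_pow_left₀ h0 h1 2
      _ = 1 := one_pow 2
  nlinarith [h2]

/-- ★★ **THE WINDOWS OF RECORD**: the member's `e ≤ e_P(s) := (5396·L^{2s})⁻¹` gives both box windows at `R_f` for `0 ≤ α ≤ e·η²`. -/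
theorem member_windows_of_le {e α : ℝ} (he0 : 0 ≤ e) (he : e ≤ (5396 * ((F.L : ℝ) ^ s) ^ 2)⁻¹)
    (hα : 0 ≤ α) (hαe : α ≤ e * eta F n K ^ 2) :
    64 * ((F.P K).d : ℝ) ^ 3 * 2
        * (((2 * ((F.L ^ s : ℕ) : ℤ) + 1) * ((F.L ^ (K - n) : ℕ) : ℤ) + (((F.L ^ (K - n) : ℕ) : ℤ) - 1) / 2 : ℤ) : ℝ) ^ 3
        * (2 * (((2 * ((F.L ^ s : ℕ) : ℤ) + 1) * ((F.L ^ (K - n) : ℕ) : ℤ) + (((F.L ^ (K - n) : ℕ) : ℤ) - 1) / 2 : ℤ) : ℝ) + 1) * α ^ 2 ≤ 1 ∧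
    832 * ((F.P K).d : ℝ) ^ 3
        * (2 * (((2 * ((F.L ^ s : ℕ) : ℤ) + 1) * ((F.L ^ (K - n) : ℕ) : ℤ) + (((F.L ^ (K - n) : ℕ) : ℤ) - 1) / 2 : ℤ) : ℝ) + 1) ^ 2
        * (((2 * ((F.L ^ s : ℕ) : ℤ) + 1) * ((F.L ^ (K - n) : ℕ) : ℤ) + (((F.L ^ (K - n) : ℕ) : ℤ) - 1) / 2 : ℤ) : ℝ) ^ 2 * α ^ 2 ≤ 1 :=
  member_windows F n K s hα hαe (window_of_le F s he0 he)

end Summit.QuantumFields.YangMills.Theorems.Prop7DivRecoveryMemberWindows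

end
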